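import Summits.QuantumFields.YangMills.Theorems.UnitScaleTiltProp7TrueLinIterHasDeriv
import Summits.QuantumFields.YangMills.Theorems.UnitScaleTiltProp7FirstVariationMultiplier
import Summits.QuantumFields.YangMills.Theorems.UnitScaleTiltProp7CovIterLambdaBound
import Summits.QuantumFields.YangMills.Theorems.UnitScaleTiltProp7LinGaugeInvariance
import HarnessLib

/-!
# Route `UnitScaleTilt`, crux K1 «MinimiserStabilityRegPr» (stmt-QuantumFields-19200), route-R row (R-δ) (★p1 g12 2026-08-28), FILE 2 of 2 —
# THE EXACT-PAIRING MULTIPLIER THEOREM AT AN R2-CRITICAL CONFIGURATION, IN THE ALGEBRAIC `Q`-CURRENCY: `|Lin_{U₀}(A)| ≤ 2ε₀ℓ⁻¹·Σ_c‖Q (K−n) A c‖`,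
# `Lin_{U₀} = Λ ∘ Q (K−n)` for a real-linear functional `Λ` on coarse bond fields, and `Λ` kills every coarse pure gauge

Cell `ym3-torus`, keyed width hand `ym-routeR-w2` (gen 1).  THEOREMS ONLY (0 `def`, 0 `sorry`); `--supports stmt-QuantumFields-19200`, count-neutral.  YM₃ on T³ is a ladder
rung (R3), not the Clay problem; nothing here claims a stub, the crux, d = 4 or the mass gap.

WHY (memo #54 §4's open S-row, ★p1 g12's (R-δ)).  The cell's first-variation machine (`Prop7FirstVariationMultiplier.abs_lin_le_constraint_velocity`, curve currency) and its
constraint-velocity budgets (`Prop7FibreLevelMass*`, `Prop7CurvedLandauCoreBudgetsRelPlaqT3`'s `ZQ`, algebraic currency `Q`) meet here: by FILE 1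
(`Prop7TrueLinIterHasDeriv.hasDerivAt_iter`) the velocity of the `(K−n)`-fold average along `s ↦ e^{sA}U₀` IS `(Q (K−n) A)(c)·V_c`, so the multiplier bound reads
`|Lin_{U₀}(A)| ≤ 2ε₀L^{−(K−n)}·Σ_c‖Q (K−n) A c‖` (§1).  Hence `Lin_{U₀}` vanishes on `ker Q (K−n)` inside the real space of `𝔰𝔲(2)`-valued bond fields and FACTORS through
`Q (K−n)` (§2, linear algebra — no surjectivity, no right inverse); and since `Lin_{U₀}` kills every fine gauge direction (`Prop7LinGaugeInvariance.lin_gaugeDir_eq_zero`) while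
`Q (K−n)` maps it to the coarse gauge direction of the centre values (`Prop7TrueLinPureGaugeIter.trueLinIter_pureGauge`), the multiplier kills every coarse pure gauge (§3) —
the Lagrange orthogonality `⟨λ, D_V ν⟩ = 0` of the located (Λ)-analysis, as a theorem.

WHAT IS PROVED (ns `…Theorems.Prop7FirstVariationExactPairing`; T³, SU(2)).
* §0 `tower_loop_rows_of_regPr` — the tower rows `hα ∕ ha24 ∕ haN` of FILE 1 from `RegPr ε₀ U₀` and `10¹⁰L⁶ε₀ ≤ 1` (constant profile `a = ((d+2)L)²∕4·2ε₀`).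
* §1 ★★ `abs_lin_le_sum_norm_trueLinIter`.
* §2 `exists_factor_of_ker_le` (linear algebra), ★★ `exists_multiplier_functional`.
* §3 ★ `multiplier_coarseGauge_eq_zero`.

HONEST SCOPE.  Bookkeeping over landed theorems; the multiplier is a real-linear FUNCTIONAL (its Riesz representative `λ` is not spelled out); nothing of Bałaban's analysis is asserted.

References: T. Bałaban, CMP 102 (1985) 277–309 [Balaban1985Variational] ((2), (6) p.278, (141)–(143) p.299); CMP 99 (1985) 389–434 [Balaban1985BackgroundPropagators]
((3.9)–(3.11) p.392); CMP 98 (1985) 17–51 [Balaban1985Averaging] ((11) p.19, (122)–(125) p.36).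
-/

set_option autoImplicit false

noncomputable section

open scoped BigOperators Matrix.Norms.L2Operator Matrix Topology

namespace Summit.QuantumFields.YangMills.Theorems.Prop7FirstVariationExactPairing

open Filter NormedSpace
open Literature.MathematicalPhysics.QuantumFieldTheory.Balaban1983to89
open Literature.MathematicalPhysics.QuantumFieldTheory.Balaban1983to89.T3ContinuumYM3Torus
open T4Continuum BlockAveraging AveragingRT ExpMeanLog BlockAveragingEMLLinearised BlockAveragingEMLLinearisedBackground BlockAveragingEMLProp2
open T3RegularMinimiser T3PrintedRegularMinimiser T3Thm1CarrierNative
open B15DeterminingSets (embIter)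
open B10Eq27TorusAxialLog (unitsField toUField)
open B10Eq68TorusRegularity (covDivT)
open Summit.QuantumFields.YangMills.Theorems.Prop7TrueLinIterHasDeriv (hasDerivAt_iter)
open Summit.QuantumFields.YangMills.Theorems.Prop7FirstVariationMultiplier (abs_lin_le_constraint_velocity)
open Summit.QuantumFields.YangMills.Theorems.Prop7CovIterLambdaBound (tower_plaq_lt)
open Summit.QuantumFields.YangMills.Theorems.Prop7HolRatioPerStep (coe_mul_star_self)
open Summit.QuantumFields.YangMills.Theorems.Prop8Criticality (expCurve_mem)

variable (F : T3Family) {n K : ℕ}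

/-! ## §0 The tower rows from `RegPr` -/

/-- **THE TOWER'S LOOP VARIABLES ARE REGULAR** under `RegPr ε₀ U₀`, `10¹⁰L⁶ε₀ ≤ 1`: at every level `j < K − n` the (0.4) loop variables of `Ū₀^{(j)}` are within
`((d+2)L)²∕4·2ε₀ ≤ 1∕24 < δ_{SU(2)} = 1∕3` of `1` (`Prop7CovIterLambdaBound.tower_plaq_lt` + `LatticeWordStokes.dist1_loopHol_le`). [cite: Balaban1985Averaging, Prop. 2 (53) p.26] -/
theorem tower_loop_rows_of_regPr {ε₀ : ℝ} (hε₀ : 0 < ε₀) (hε : 10 ^ 10 * (F.L : ℝ) ^ 6 * ε₀ ≤ 1)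
    {U₀ : GaugeField (F.P K) 0 (Matrix.specialUnitaryGroup (Fin 2) ℂ)} (hU₀reg : RegPr F n K ε₀ U₀) :
    (∀ j < K - n, ∀ (c : PBond (F.P K) (j + 1)) (i : Idx (F.P K)),
        dist1 (loopHol (Averaging.iter (fun i => blockAvg (P := F.P K) (j := i) (expMeanLogSU (n := Fin 2))) j U₀) c i)
          ≤ (fun _ : ℕ => ((((F.P K).d + 2) * (F.P K).L : ℕ) : ℝ) ^ 2 / 4 * (2 * ε₀)) j) ∧
      (∀ j < K - n, (fun _ : ℕ => ((((F.P K).d + 2) * (F.P K).L : ℕ) : ℝ) ^ 2 / 4 * (2 * ε₀)) j ≤ 1 / 24) ∧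
      (∀ j < K - n, (fun _ : ℕ => ((((F.P K).d + 2) * (F.P K).L : ℕ) : ℝ) ^ 2 / 4 * (2 * ε₀)) j < deltaSU (Fin 2)) := by
  have hL3 : (3 : ℝ) ≤ (F.L : ℝ) := by
    have h : 3 ≤ F.L := by obtain ⟨a, ha⟩ := F.hL.1; have := F.hL.2; omega
    exact_mod_cast h
  have hL1 : (1 : ℝ) ≤ F.L := by linarith
  have hPL : ((F.P K).L : ℝ) = F.L := rfl
  have hd : (F.P K).d = 3 := T3Family.P_d F K
  have hδ : deltaSU (Fin 2) = 1 / 3 := by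
    unfold deltaSU
    rw [Fintype.card_fin]
    refine min_eq_left ?_
    rw [le_div_iff₀ (by norm_num)]
    have := Real.pi_gt_three; push_cast; linarith
  have hL6 : (F.L : ℝ) ^ 2 ≤ (F.L : ℝ) ^ 6 := pow_le_pow_right₀ hL1 (by norm_num)
  have hL2ε : (F.L : ℝ) ^ 2 * ε₀ ≤ 1 / 10 ^ 10 := by
    rw [le_div_iff₀ (by positivity)]; nlinarith [hε₀.le, hL6]
  have hε1 : ε₀ ≤ 1 / 10 ^ 10 := by
    have h9 : (9 : ℝ) ≤ (F.L : ℝ) ^ 2 := by nlinarith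
    have : ε₀ ≤ (F.L : ℝ) ^ 2 * ε₀ := by nlinarith [hε₀.le]
    exact this.trans hL2ε
  -- the constant of the profile, numerically
  have hconst : ((((F.P K).d + 2) * (F.P K).L : ℕ) : ℝ) ^ 2 / 4 * (2 * ε₀) = 25 / 2 * ((F.L : ℝ) ^ 2 * ε₀) := by
    rw [hd]; push_cast; rw [hPL]; ring
  refine ⟨?_, ?_, ?_⟩
  · intro j hj c i
    -- `PlaqSmall (ε₀ ℓ⁻²) U₀` from `RegPr`
    have hU : PlaqSmall (ε₀ * ((((F.P K).L : ℝ) ^ (K - n))⁻¹) ^ 2) U₀ := by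
      intro q
      have h1 := hU₀reg.plaqSmall q
      have h2 : regThreshold F n K ε₀ = ε₀ * ((((F.P K).L : ℝ) ^ (K - n))⁻¹) ^ 2 := by
        rw [regThreshold, hPL, inv_pow, inv_pow, mul_comm 2 (K - n), pow_mul]
      rwa [h2] at h1
    have hε3 : (143 * (((((F.P K).d + 4 : ℕ) : ℝ)) ^ 2 / 4) ^ 2) * ε₀ ≤ 1 / 3 := by
      rw [hd]; push_cast; nlinarith [hε1]
    have hε2 : 2 * ε₀ ≤ 2 * deltaSU (Fin 2) / ((((F.P K).d + 4) * (F.P K).L : ℕ) : ℝ) ^ 2 := by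
      rw [hδ, hd]; push_cast; rw [hPL]
      rw [le_div_iff₀ (by positivity)]
      nlinarith [hL2ε]
    have hpl : PlaqSmall (2 * ε₀ * (((F.P K).L : ℝ) ^ j * (((F.P K).L : ℝ) ^ (K - n))⁻¹) ^ 2)
        (Averaging.iter (fun i => blockAvg (P := F.P K) (j := i) (expMeanLogSU (n := Fin 2))) j U₀) :=
      fun q => (tower_plaq_lt (K - n) hε₀ hε3 hε2 hU hj.le q).1
    have h := LatticeWordStokes.dist1_loopHol_le (by positivity) hpl c i
    refine h.trans ?_
    have hx1 : ((F.P K).L : ℝ) ^ j * (((F.P K).L : ℝ) ^ (K - n))⁻¹ ≤ 1 := by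
      rw [hPL, mul_inv_le_iff₀ (by positivity), one_mul]; exact pow_le_pow_right₀ hL1 hj.le
    have hx0 : 0 ≤ ((F.P K).L : ℝ) ^ j * (((F.P K).L : ℝ) ^ (K - n))⁻¹ := by rw [hPL]; positivity
    have : 2 * ε₀ * (((F.P K).L : ℝ) ^ j * (((F.P K).L : ℝ) ^ (K - n))⁻¹) ^ 2 ≤ 2 * ε₀ :=
      mul_le_of_le_one_right (by positivity) (pow_le_one₀ hx0 hx1)
    exact mul_le_mul_of_nonneg_left this (by positivity)
  · intro j _
    show ((((F.P K).d + 2) * (F.P K).L : ℕ) : ℝ) ^ 2 / 4 * (2 * ε₀) ≤ 1 / 24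
    rw [hconst]; nlinarith [hL2ε]
  · intro j _
    show ((((F.P K).d + 2) * (F.P K).L : ℕ) : ℝ) ^ 2 / 4 * (2 * ε₀) < deltaSU (Fin 2)
    rw [hconst, hδ]; nlinarith [hL2ε]

/-! ## §1 ★★ The multiplier bound in the `Q`-currency -/

/-- ★★ **`|Lin_{U₀}(A)| ≤ 2ε₀L^{−(K−n)}·Σ_c‖(Q (K−n) A)(c)‖`** for every R2-critical `U₀ ∈ (6)(ε₀)` (`10¹⁰L⁶ε₀ ≤ 1`), every `𝔰𝔲(2)`-valued bond field `A` and every recursion family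
`Q` of the true one-step linearisations along `U₀`'s tower (`hQ0 ∕ hQs`): the curve-currency bound `Prop7FirstVariationMultiplier.abs_lin_le_constraint_velocity` along
`Γ₀(s) = e^{sA}U₀`, whose averaged velocity is `(Q (K−n) A)(c)·V_c` by FILE 1. [cite: Balaban1985Variational, (141)-(143) p.299; Balaban1985BackgroundPropagators, (3.11) p.392] -/
theorem abs_lin_le_sum_norm_trueLinIter (hnK : n ≤ K)
    {V : GaugeField (F.P n) 0 (Matrix.specialUnitaryGroup (Fin 2) ℂ)} {U₀ : GaugeField (F.P K) 0 (Matrix.specialUnitaryGroup (Fin 2) ℂ)}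
    (hcrit : IsCritR2 F n K hnK V U₀) {ε₀ : ℝ} (hε₀ : 0 < ε₀) (hε : 10 ^ 10 * (F.L : ℝ) ^ 6 * ε₀ ≤ 1) (hU₀reg : RegPr F n K ε₀ U₀)
    (Q : (k : ℕ) → (PBond (F.P K) 0 → Matrix (Fin 2) (Fin 2) ℂ) → PBond (F.P K) k → Matrix (Fin 2) (Fin 2) ℂ) (hQ0 : ∀ Y, Q 0 Y = Y)
    (hQs : ∀ (k : ℕ) (Y : PBond (F.P K) 0 → Matrix (Fin 2) (Fin 2) ℂ) (c : PBond (F.P K) (k + 1)), Q (k + 1) Y c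
      = fderiv ℂ (eml : (Idx (F.P K) → Matrix (Fin 2) (Fin 2) ℂ) → Matrix (Fin 2) (Fin 2) ℂ)
            (fun i => ((loopHol (Averaging.iter (fun i => blockAvg (P := F.P K) (j := i) (expMeanLogSU (n := Fin 2))) k U₀) c i :
              Matrix.specialUnitaryGroup (Fin 2) ℂ) : Matrix (Fin 2) (Fin 2) ℂ))
            (fun i => covWalkSum (Averaging.iter (fun i => blockAvg (P := F.P K) (j := i) (expMeanLogSU (n := Fin 2))) k U₀) (Q k Y)
                (walk (emb c.src) (loopWord (F.P K).L c.dir (off i.1) i.2.1 i.2.2))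
              * ((loopHol (Averaging.iter (fun i => blockAvg (P := F.P K) (j := i) (expMeanLogSU (n := Fin 2))) k U₀) c i :
                Matrix.specialUnitaryGroup (Fin 2) ℂ) : Matrix (Fin 2) (Fin 2) ℂ))
            * star ((corr (expMeanLogSU (n := Fin 2)) (Averaging.iter (fun i => blockAvg (P := F.P K) (j := i) (expMeanLogSU (n := Fin 2))) k U₀) c :
                Matrix.specialUnitaryGroup (Fin 2) ℂ) : Matrix (Fin 2) (Fin 2) ℂ)
          + ((corr (expMeanLogSU (n := Fin 2)) (Averaging.iter (fun i => blockAvg (P := F.P K) (j := i) (expMeanLogSU (n := Fin 2))) k U₀) c :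
                Matrix.specialUnitaryGroup (Fin 2) ℂ) : Matrix (Fin 2) (Fin 2) ℂ)
            * covWalkSum (Averaging.iter (fun i => blockAvg (P := F.P K) (j := i) (expMeanLogSU (n := Fin 2))) k U₀) (Q k Y)
                (walk (emb c.src) (List.replicate (F.P K).L (c.dir, true)))
            * star ((corr (expMeanLogSU (n := Fin 2)) (Averaging.iter (fun i => blockAvg (P := F.P K) (j := i) (expMeanLogSU (n := Fin 2))) k U₀) c :
                Matrix.specialUnitaryGroup (Fin 2) ℂ) : Matrix (Fin 2) (Fin 2) ℂ))
    (A : PBond (F.P K) 0 → Matrix (Fin 2) (Fin 2) ℂ) (hA : ∀ b, A b ∈ skewAdjoint (Matrix (Fin 2) (Fin 2) ℂ)) (htr : ∀ b, (A b).trace = 0) :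
    |∑ p : Plaq (F.P K) 0, (1 / 2) * ((((((GaugeField.plaqHol U₀ p : Matrix.specialUnitaryGroup (Fin 2) ℂ) : Matrix (Fin 2) (Fin 2) ℂ)) - 1)ᴴ
          * ((A ⟨p.src, p.μ⟩
              + (U₀ ⟨p.src, p.μ⟩ : Matrix (Fin 2) (Fin 2) ℂ) * A ⟨p.src.shift p.μ, p.ν⟩ * star (U₀ ⟨p.src, p.μ⟩ : Matrix (Fin 2) (Fin 2) ℂ)
              - ((U₀ ⟨p.src, p.μ⟩ * U₀ ⟨p.src.shift p.μ, p.ν⟩ * (U₀ ⟨p.src.shift p.ν, p.μ⟩)⁻¹ : Matrix.specialUnitaryGroup (Fin 2) ℂ) : Matrix (Fin 2) (Fin 2) ℂ)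
                  * A ⟨p.src.shift p.ν, p.μ⟩
                  * star ((U₀ ⟨p.src, p.μ⟩ * U₀ ⟨p.src.shift p.μ, p.ν⟩ * (U₀ ⟨p.src.shift p.ν, p.μ⟩)⁻¹ : Matrix.specialUnitaryGroup (Fin 2) ℂ) : Matrix (Fin 2) (Fin 2) ℂ)
              - ((GaugeField.plaqHol U₀ p : Matrix.specialUnitaryGroup (Fin 2) ℂ) : Matrix (Fin 2) (Fin 2) ℂ) * A ⟨p.src, p.ν⟩
                  * star ((GaugeField.plaqHol U₀ p : Matrix.specialUnitaryGroup (Fin 2) ℂ) : Matrix (Fin 2) (Fin 2) ℂ))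
            * ((GaugeField.plaqHol U₀ p : Matrix.specialUnitaryGroup (Fin 2) ℂ) : Matrix (Fin 2) (Fin 2) ℂ))).trace).re|
      ≤ 2 * ε₀ * ((F.L : ℝ) ^ (K - n))⁻¹ * ∑ c : PBond (F.P K) (K - n), ‖Q (K - n) A c‖ := by
  classical
  -- the exponential family and its velocities
  set Γ₀ : ℝ → GaugeField (F.P K) 0 (Matrix.specialUnitaryGroup (Fin 2) ℂ) :=
    fun t b => ⟨exp (t • A b) * (U₀ b : Matrix (Fin 2) (Fin 2) ℂ), expCurve_mem (hA b) (htr b) (U₀ b) t⟩ with hΓ₀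
  have hΓ₀0 : Γ₀ 0 = U₀ := by
    funext b; apply Subtype.ext
    show exp ((0 : ℝ) • A b) * (U₀ b : Matrix (Fin 2) (Fin 2) ℂ) = (U₀ b : Matrix (Fin 2) (Fin 2) ℂ)
    rw [zero_smul, exp_zero, one_mul]
  have hΓ₀d : ∀ b : PBond (F.P K) 0, HasDerivAt (fun t : ℝ => (Γ₀ t b : Matrix (Fin 2) (Fin 2) ℂ)) (A b * (U₀ b : Matrix (Fin 2) (Fin 2) ℂ)) 0 := by
    intro b
    have h1 := (hasDerivAt_exp_smul_const' (A b) (0 : ℝ)).mul_const (U₀ b : Matrix (Fin 2) (Fin 2) ℂ)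
    simp only [zero_smul, exp_zero, mul_one] at h1
    exact h1
  have hUU : ∀ b : PBond (F.P K) 0, (U₀ b : Matrix (Fin 2) (Fin 2) ℂ) * star (U₀ b : Matrix (Fin 2) (Fin 2) ℂ) = 1 := fun b => coe_mul_star_self _
  have hratio : ∀ b : PBond (F.P K) 0, HasDerivAt (fun s : ℝ => ((Γ₀ s b : Matrix.specialUnitaryGroup (Fin 2) ℂ) : Matrix (Fin 2) (Fin 2) ℂ) *
      star ((U₀ b : Matrix.specialUnitaryGroup (Fin 2) ℂ) : Matrix (Fin 2) (Fin 2) ℂ)) (A b) 0 := by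
    intro b
    have h := (hΓ₀d b).mul_const (star ((U₀ b : Matrix.specialUnitaryGroup (Fin 2) ℂ) : Matrix (Fin 2) (Fin 2) ℂ))
    rwa [Matrix.mul_assoc, hUU, Matrix.mul_one] at h
  obtain ⟨hα, ha24, haN⟩ := tower_loop_rows_of_regPr F hε₀ hε hU₀reg (K := K) (n := n)
  have hmain := abs_lin_le_constraint_velocity F hnK hcrit hε₀ hε hU₀reg Γ₀ hΓ₀0 A hΓ₀d
  refine hmain.trans (le_of_eq ?_)
  congr 1
  refine Finset.sum_congr rfl fun c _ => ?_
  rw [(hasDerivAt_iter U₀ Γ₀ hΓ₀0 A hratio Q hQ0 hQs _ hα ha24 haN c).deriv]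
  exact CStarRing.norm_mul_mem_unitary _ (Matrix.specialUnitaryGroup_le_unitaryGroup (Averaging.iter _ (K - n) U₀ c).2)

/-! ## §2 ★★ The multiplier functional -/

/-- Linear algebra: a real-linear functional that vanishes on the kernel of a linear map FACTORS through it (quotient by the kernel ≅ range, then extend from the range;
no surjectivity needed). [folklore] -/
theorem exists_factor_of_ker_le {E G : Type*} [AddCommGroup E] [Module ℝ E] [AddCommGroup G] [Module ℝ G]
    (L : E →ₗ[ℝ] ℝ) (T : E →ₗ[ℝ] G) (h : LinearMap.ker T ≤ LinearMap.ker L) :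
    ∃ Λ : G →ₗ[ℝ] ℝ, ∀ x, L x = Λ (T x) := by
  let g : LinearMap.range T →ₗ[ℝ] ℝ := ((LinearMap.ker T).liftQ L h) ∘ₗ T.quotKerEquivRange.symm.toLinearMap
  obtain ⟨Λ, hΛ⟩ := LinearMap.exists_extend g
  refine ⟨Λ, fun x => ?_⟩
  have hx : T x ∈ LinearMap.range T := LinearMap.mem_range_self T x
  have e1 : Λ (T x) = g ⟨T x, hx⟩ := by
    have := LinearMap.congr_fun hΛ ⟨T x, hx⟩
    simpa only [LinearMap.comp_apply, Submodule.subtype_apply] using this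
  have e2 : T.quotKerEquivRange.symm ⟨T x, hx⟩ = Submodule.Quotient.mk x := by
    rw [LinearEquiv.symm_apply_eq]
    apply Subtype.ext
    exact (LinearMap.quotKerEquivRange_apply_mk T x).symm
  rw [e1]
  show L x = ((LinearMap.ker T).liftQ L h) (T.quotKerEquivRange.symm ⟨T x, hx⟩)
  rw [e2, Submodule.liftQ_apply]

/-- `𝔰𝔲(2)` is closed under conjugation-minus: for `ξ(x), ξ(x′) ∈ 𝔰𝔲(2)` and `U` special unitary, `ξ(x) − Uξ(x′)U*` is skew-adjoint and traceless. [folklore] -/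
theorem gaugeDir_mem_su2 {ξ ξ' : Matrix (Fin 2) (Fin 2) ℂ} (hξ : ξ ∈ skewAdjoint (Matrix (Fin 2) (Fin 2) ℂ)) (hξt : ξ.trace = 0)
    (hξ' : ξ' ∈ skewAdjoint (Matrix (Fin 2) (Fin 2) ℂ)) (hξ't : ξ'.trace = 0) (U : Matrix.specialUnitaryGroup (Fin 2) ℂ) :
    ξ - (U : Matrix (Fin 2) (Fin 2) ℂ) * ξ' * star (U : Matrix (Fin 2) (Fin 2) ℂ) ∈ skewAdjoint (Matrix (Fin 2) (Fin 2) ℂ) ∧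
      (ξ - (U : Matrix (Fin 2) (Fin 2) ℂ) * ξ' * star (U : Matrix (Fin 2) (Fin 2) ℂ)).trace = 0 := by
  constructor
  · rw [skewAdjoint.mem_iff] at hξ hξ' ⊢
    rw [star_sub, star_mul, star_mul, star_star, hξ, hξ', ← Matrix.mul_assoc, Matrix.mul_neg, Matrix.neg_mul, neg_sub]
    abel
  · have hUU : star (U : Matrix (Fin 2) (Fin 2) ℂ) * (U : Matrix (Fin 2) (Fin 2) ℂ) = 1 := Prop7HolRatioPerStep.coe_star_mul_self U
    rw [Matrix.trace_sub, Matrix.trace_mul_cycle, hUU, Matrix.one_mul, hξt, hξ't, sub_self]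

/-- ★★ **THE EXACT-PAIRING MULTIPLIER THEOREM.**  For an R2-critical `U₀ ∈ (6)(ε₀)` (`10¹⁰L⁶ε₀ ≤ 1`) and every recursion family `Q` of the true one-step linearisations
along its tower there is a real-linear functional `Λ` on the level-`(K−n)` bond fields — the Lagrange multiplier of the (0.4)-constraint — with
(i) `Lin_{U₀}(A) = Λ (Q (K−n) A)` for EVERY `𝔰𝔲(2)`-valued bond field `A` (exact pairing, §1 + `exists_factor_of_ker_le`), and
(ii) `Λ (c ↦ ξ(embIter c₋) − V_c·ξ(embIter c₊)·V_c*) = 0` for every `𝔰𝔲(2)`-valued site field `ξ`, `V = Ū₀^{(K−n)}` (the multiplier is orthogonal to every infinitesimal COARSE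
gauge direction: `Q` maps the fine gauge direction of `ξ` to the coarse one of its centre values — `Prop7TrueLinPureGaugeIter.trueLinIter_pureGauge` — and `Lin_{U₀}` kills the
former — `Prop7LinGaugeInvariance.lin_gaugeDir_eq_zero`). [cite: Balaban1985Variational, (141)-(143) p.299; Balaban1985BackgroundPropagators, (3.9)-(3.11) p.392; Balaban1985Averaging, (11) p.19] -/
theorem exists_multiplier_functional (hnK : n ≤ K)
    {V : GaugeField (F.P n) 0 (Matrix.specialUnitaryGroup (Fin 2) ℂ)} {U₀ : GaugeField (F.P K) 0 (Matrix.specialUnitaryGroup (Fin 2) ℂ)}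
    (hcrit : IsCritR2 F n K hnK V U₀) {ε₀ : ℝ} (hε₀ : 0 < ε₀) (hε : 10 ^ 10 * (F.L : ℝ) ^ 6 * ε₀ ≤ 1) (hU₀reg : RegPr F n K ε₀ U₀)
    (Q : (k : ℕ) → (PBond (F.P K) 0 → Matrix (Fin 2) (Fin 2) ℂ) → PBond (F.P K) k → Matrix (Fin 2) (Fin 2) ℂ) (hQ0 : ∀ Y, Q 0 Y = Y)
    (hQs : ∀ (k : ℕ) (Y : PBond (F.P K) 0 → Matrix (Fin 2) (Fin 2) ℂ) (c : PBond (F.P K) (k + 1)), Q (k + 1) Y c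
      = fderiv ℂ (eml : (Idx (F.P K) → Matrix (Fin 2) (Fin 2) ℂ) → Matrix (Fin 2) (Fin 2) ℂ)
            (fun i => ((loopHol (Averaging.iter (fun i => blockAvg (P := F.P K) (j := i) (expMeanLogSU (n := Fin 2))) k U₀) c i :
              Matrix.specialUnitaryGroup (Fin 2) ℂ) : Matrix (Fin 2) (Fin 2) ℂ))
            (fun i => covWalkSum (Averaging.iter (fun i => blockAvg (P := F.P K) (j := i) (expMeanLogSU (n := Fin 2))) k U₀) (Q k Y)
                (walk (emb c.src) (loopWord (F.P K).L c.dir (off i.1) i.2.1 i.2.2))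
              * ((loopHol (Averaging.iter (fun i => blockAvg (P := F.P K) (j := i) (expMeanLogSU (n := Fin 2))) k U₀) c i :
                Matrix.specialUnitaryGroup (Fin 2) ℂ) : Matrix (Fin 2) (Fin 2) ℂ))
            * star ((corr (expMeanLogSU (n := Fin 2)) (Averaging.iter (fun i => blockAvg (P := F.P K) (j := i) (expMeanLogSU (n := Fin 2))) k U₀) c :
                Matrix.specialUnitaryGroup (Fin 2) ℂ) : Matrix (Fin 2) (Fin 2) ℂ)
          + ((corr (expMeanLogSU (n := Fin 2)) (Averaging.iter (fun i => blockAvg (P := F.P K) (j := i) (expMeanLogSU (n := Fin 2))) k U₀) c :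
                Matrix.specialUnitaryGroup (Fin 2) ℂ) : Matrix (Fin 2) (Fin 2) ℂ)
            * covWalkSum (Averaging.iter (fun i => blockAvg (P := F.P K) (j := i) (expMeanLogSU (n := Fin 2))) k U₀) (Q k Y)
                (walk (emb c.src) (List.replicate (F.P K).L (c.dir, true)))
            * star ((corr (expMeanLogSU (n := Fin 2)) (Averaging.iter (fun i => blockAvg (P := F.P K) (j := i) (expMeanLogSU (n := Fin 2))) k U₀) c :
                Matrix.specialUnitaryGroup (Fin 2) ℂ) : Matrix (Fin 2) (Fin 2) ℂ)) :
    ∃ Λ : (PBond (F.P K) (K - n) → Matrix (Fin 2) (Fin 2) ℂ) →ₗ[ℝ] ℝ,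
      (∀ A : PBond (F.P K) 0 → Matrix (Fin 2) (Fin 2) ℂ, (∀ b, A b ∈ skewAdjoint (Matrix (Fin 2) (Fin 2) ℂ)) → (∀ b, (A b).trace = 0) →
        ∑ p : Plaq (F.P K) 0, (1 / 2) * ((((((GaugeField.plaqHol U₀ p : Matrix.specialUnitaryGroup (Fin 2) ℂ) : Matrix (Fin 2) (Fin 2) ℂ)) - 1)ᴴ
          * ((A ⟨p.src, p.μ⟩
              + (U₀ ⟨p.src, p.μ⟩ : Matrix (Fin 2) (Fin 2) ℂ) * A ⟨p.src.shift p.μ, p.ν⟩ * star (U₀ ⟨p.src, p.μ⟩ : Matrix (Fin 2) (Fin 2) ℂ)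
              - ((U₀ ⟨p.src, p.μ⟩ * U₀ ⟨p.src.shift p.μ, p.ν⟩ * (U₀ ⟨p.src.shift p.ν, p.μ⟩)⁻¹ : Matrix.specialUnitaryGroup (Fin 2) ℂ) : Matrix (Fin 2) (Fin 2) ℂ)
                  * A ⟨p.src.shift p.ν, p.μ⟩
                  * star ((U₀ ⟨p.src, p.μ⟩ * U₀ ⟨p.src.shift p.μ, p.ν⟩ * (U₀ ⟨p.src.shift p.ν, p.μ⟩)⁻¹ : Matrix.specialUnitaryGroup (Fin 2) ℂ) : Matrix (Fin 2) (Fin 2) ℂ)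
              - ((GaugeField.plaqHol U₀ p : Matrix.specialUnitaryGroup (Fin 2) ℂ) : Matrix (Fin 2) (Fin 2) ℂ) * A ⟨p.src, p.ν⟩
                  * star ((GaugeField.plaqHol U₀ p : Matrix.specialUnitaryGroup (Fin 2) ℂ) : Matrix (Fin 2) (Fin 2) ℂ))
            * ((GaugeField.plaqHol U₀ p : Matrix.specialUnitaryGroup (Fin 2) ℂ) : Matrix (Fin 2) (Fin 2) ℂ))).trace).re = Λ (Q (K - n) A)) ∧
      (∀ ξ : Site (F.P K) 0 → Matrix (Fin 2) (Fin 2) ℂ, (∀ x, ξ x ∈ skewAdjoint (Matrix (Fin 2) (Fin 2) ℂ)) → (∀ x, (ξ x).trace = 0) →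
        Λ (fun c : PBond (F.P K) (K - n) => ξ (embIter (K - n) c.src)
          - ((Averaging.iter (fun i => blockAvg (P := F.P K) (j := i) (expMeanLogSU (n := Fin 2))) (K - n) U₀ c : Matrix.specialUnitaryGroup (Fin 2) ℂ) :
              Matrix (Fin 2) (Fin 2) ℂ) * ξ (embIter (K - n) c.tgt)
            * star ((Averaging.iter (fun i => blockAvg (P := F.P K) (j := i) (expMeanLogSU (n := Fin 2))) (K - n) U₀ c : Matrix.specialUnitaryGroup (Fin 2) ℂ) :
              Matrix (Fin 2) (Fin 2) ℂ)) = 0) := by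
  classical
  -- the real subspace of `𝔰𝔲(2)`-valued bond fields
  let S : Submodule ℝ (PBond (F.P K) 0 → Matrix (Fin 2) (Fin 2) ℂ) :=
    { carrier := {A | ∀ b, A b ∈ skewAdjoint (Matrix (Fin 2) (Fin 2) ℂ) ∧ (A b).trace = 0}
      add_mem' := fun {A B} hA hB b => ⟨by rw [Pi.add_apply]; exact (skewAdjoint _).add_mem (hA b).1 (hB b).1,
        by rw [Pi.add_apply, Matrix.trace_add, (hA b).2, (hB b).2, add_zero]⟩
      zero_mem' := fun b => ⟨by rw [Pi.zero_apply]; exact (skewAdjoint _).zero_mem, by rw [Pi.zero_apply, Matrix.trace_zero]⟩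
      smul_mem' := fun r A hA b => ⟨by rw [Pi.smul_apply]; exact skewAdjoint.smul_mem r (hA b).1,
        by rw [Pi.smul_apply, Matrix.trace_smul, (hA b).2, smul_zero]⟩ }
  -- `Lin_{U₀}` as a real-linear functional on `S` (via the current pairing)
  let L : S →ₗ[ℝ] ℝ :=
    { toFun := fun A => -(1 / 2) * ∑ b : PBond (F.P K) 0, ((A.1 b * covDivT 1 (unitsField (toUField U₀)) b.dir b.src).trace).re
      map_add' := fun A B => by
        simp only [Submodule.coe_add, Pi.add_apply, Matrix.add_mul, Matrix.trace_add, Complex.add_re, Finset.sum_add_distrib]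
        ring
      map_smul' := fun r A => by
        simp only [Submodule.coe_smul, Pi.smul_apply, Matrix.smul_mul, Matrix.trace_smul, Complex.smul_re, ← Finset.mul_sum,
          RingHom.id_apply, smul_eq_mul]
        ring }
  -- `Q (K−n)` as a real-linear map on `S`
  let T : S →ₗ[ℝ] (PBond (F.P K) (K - n) → Matrix (Fin 2) (Fin 2) ℂ) :=
    { toFun := fun A => Q (K - n) A.1
      map_add' := fun A B => by
        funext c
        rw [Submodule.coe_add, Pi.add_apply]
        exact Prop7TrueLinPureGaugeIter.trueLinIter_add U₀ Q hQ0 hQs (K - n) A.1 B.1 c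
      map_smul' := fun r A => by
        funext c
        have e1 : ((r • A : S) : PBond (F.P K) 0 → Matrix (Fin 2) (Fin 2) ℂ) = (r : ℂ) • (A.1 : PBond (F.P K) 0 → Matrix (Fin 2) (Fin 2) ℂ) := by
          rw [Submodule.coe_smul]; exact RCLike.real_smul_eq_coe_smul (K := ℂ) r _
        rw [e1, RingHom.id_apply, Pi.smul_apply, Prop7TrueLinPureGaugeIter.trueLinIter_smul U₀ Q hQ0 hQs (K - n) (r : ℂ) A.1 c]
        exact (RCLike.real_smul_eq_coe_smul (K := ℂ) r _).symm }
  -- `ker T ≤ ker L` by §1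
  have hker : LinearMap.ker T ≤ LinearMap.ker L := by
    intro A hA
    rw [LinearMap.mem_ker] at hA ⊢
    have hQ0' : ∀ c, Q (K - n) A.1 c = 0 := fun c => congrFun hA c
    have h1 := abs_lin_le_sum_norm_trueLinIter F hnK hcrit hε₀ hε hU₀reg Q hQ0 hQs A.1 (fun b => (A.2 b).1) (fun b => (A.2 b).2)
    simp only [hQ0', norm_zero, Finset.sum_const_zero, mul_zero] at h1
    have h0 := abs_nonpos_iff.mp h1
    rw [Prop7FirstVariationCurrent.lin_eq_neg_half_sum_re_trace_mul_covDivT] at h0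
    exact h0
  obtain ⟨Λ, hΛ⟩ := exists_factor_of_ker_le L T hker
  refine ⟨Λ, fun A hA htr => ?_, fun ξ hξ hξt => ?_⟩
  · have h := hΛ ⟨A, fun b => ⟨hA b, htr b⟩⟩
    rw [Prop7FirstVariationCurrent.lin_eq_neg_half_sum_re_trace_mul_covDivT]
    exact h
  · obtain ⟨hα, _, haN⟩ := tower_loop_rows_of_regPr F hε₀ hε hU₀reg (K := K) (n := n)
    -- the fine gauge direction of `ξ` is in `S`
    let Aξ : S := ⟨fun b : PBond (F.P K) 0 => ξ b.src - ((U₀ b : Matrix.specialUnitaryGroup (Fin 2) ℂ) : Matrix (Fin 2) (Fin 2) ℂ) * ξ b.tgt *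
        star ((U₀ b : Matrix.specialUnitaryGroup (Fin 2) ℂ) : Matrix (Fin 2) (Fin 2) ℂ),
      fun b => gaugeDir_mem_su2 (hξ b.src) (hξt b.src) (hξ b.tgt) (hξt b.tgt) (U₀ b)⟩
    have hQξ := Prop7TrueLinPureGaugeIter.trueLinIter_pureGauge U₀ Q hQ0 hQs ξ (K - n)
      (fun j hj c i => (hα j hj c i).trans_lt (haN j hj))
    have hT : T Aξ = fun c : PBond (F.P K) (K - n) => ξ (embIter (K - n) c.src)
          - ((Averaging.iter (fun i => blockAvg (P := F.P K) (j := i) (expMeanLogSU (n := Fin 2))) (K - n) U₀ c : Matrix.specialUnitaryGroup (Fin 2) ℂ) :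
              Matrix (Fin 2) (Fin 2) ℂ) * ξ (embIter (K - n) c.tgt)
            * star ((Averaging.iter (fun i => blockAvg (P := F.P K) (j := i) (expMeanLogSU (n := Fin 2))) (K - n) U₀ c : Matrix.specialUnitaryGroup (Fin 2) ℂ) :
              Matrix (Fin 2) (Fin 2) ℂ) := funext fun c => hQξ c
    have hL : L Aξ = 0 := by
      show -(1 / 2) * ∑ b : PBond (F.P K) 0, (((fun b : PBond (F.P K) 0 => ξ b.src - ((U₀ b : Matrix.specialUnitaryGroup (Fin 2) ℂ) : Matrix (Fin 2) (Fin 2) ℂ) * ξ b.tgt *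
        star ((U₀ b : Matrix.specialUnitaryGroup (Fin 2) ℂ) : Matrix (Fin 2) (Fin 2) ℂ)) b * covDivT 1 (unitsField (toUField U₀)) b.dir b.src).trace).re = 0
      rw [← Prop7FirstVariationCurrent.lin_eq_neg_half_sum_re_trace_mul_covDivT]
      exact Prop7LinGaugeInvariance.lin_gaugeDir_eq_zero U₀ ξ
    rw [← hT, ← hΛ Aξ, hL]

end Summit.QuantumFields.YangMills.Theorems.Prop7FirstVariationExactPairing

end
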